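import Summits.QuantumFields.YangMills.Theorems.UnitScaleTiltProp8ChartDoubleBarOneStepLog
import Summits.QuantumFields.YangMills.Theorems.UnitScaleTiltProp7CmapTwSCoarseColumn
import Summits.QuantumFields.YangMills.Theorems.UnitScaleTiltProp7SymFrameCovDefs
import HarnessLib

/-!
# Route `UnitScaleTilt`, crux K1 «MinimiserStabilityRegPr» (stmt-QuantumFields-19200), E′ architecture (A′) «HCOW-VIA-Σ» (★★OWNER RULING g28-№13), package P-A2 «JOINT-Σ»,
# file F1″(flat) — THE ONE-STEP DEFECT OF PRINT'S DOUBLE-BAR AVERAGE IN MASS CURRENCY AT THE FLAT BACKGROUND: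
# `Σ_c ‖log U̿(c) − |I|⁻¹Σ_i X([x, x′]_i(c))‖ ≤ 80000·d·ℓ²·Σ_b ‖X b‖²` for `U = exp X`, `‖X b‖ ≤ s`, `200ℓs ≤ 1` (`ℓ = (d+2)L`)
# — the `hr : r_l ≤ C_D·M_l` row of ✓`Prop7JointRowOfLevelMasses.jointRow_of_levelMasses` for the twisted (framed) one-step average, `C_D = 80000·d·ℓ²` L-only

Cell `ym3-torus`, extra width seat `ym-routeR-w6` (gen 7); ★routeR-w3 g6 LOCATE-PA2-JOINT-SIGMA (bc08ddff) §2 F1″ «ONE-STEP DEFECT, MASS CURRENCY» («flat+frames first»), pen named to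
routeR-w6.  THEOREMS ONLY (0 `def`, 0 `sorry`); `--supports stmt-QuantumFields-19200`, count-neutral.  YM₃ on T³ is a ladder rung (R3), not the Clay problem; nothing here
claims a stub, the crux, d = 4 or the mass gap.

THE POINT.  ★w4-19200 g3's ✓`Prop8ChartDoubleBar.norm_mlog_dbar_sub_segMean_le` IS the flat one-step defect with print's `exp[mean log]` frames ((62)∕(89)) in LOCAL SUP currency:
`‖mlog(v(y)⁻¹Ū(c)v(y′)) − |I|⁻¹Σ_i X([x,x′]_i)‖ ≤ 40000ℓ²r²` whenever `‖X b‖ ≤ r` on the bonds READ by `c` (both ends in the two blocks of `c`).  The JOINT row wants the ℓ¹-over-`c`,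
mass²-on-the-right currency of (n3) F3 (✓`Prop7LogRemainderMass`).  The passage is kinematic: choose `r := r(c)` = the LARGEST `‖X b‖` over the read set of `c` (so the sup window
`200ℓs ≤ 1` still applies and `r(c)² ≤ Σ_{read set}‖X b‖²`), then count: a fine bond is read by at most the `2d` coarse bonds incident to the block of its source
(✓`Prop7CmapTwSCoarseColumn.sum_indicator_src_add_tgt_eq`).  The FRAME part costs nothing extra here — ★p1 g17's WORD-7 caveat is about ITERATING this row (F0″∕F3″∕F4″), not about one step.

WHAT IS PROVED (ns `…Theorems.Prop7TwistedOneStepDefectFlat`; any `P`, `j + 1 ≤ m + K`, complete normed ℂ-algebra `𝔸` with `‖1‖ = 1`).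
* §1 letters: `exists_local_radius` (a local sup radius `r(c)` with `r(c) ≤ s` and `r(c)² ≤ Σ_{read set} ‖X b‖²`), `read_incident` (a read bond's source block is an end of `c`),
  `sum_read_le_two_d_mul` (the multiplicity count `Σ_c Σ_{b read by c} f b ≤ 2d·Σ_b f b` for `f ≥ 0`).
* §2 ★★ `norm_mlog_dbarAvgU_sub_segMean_le_localMass` — per coarse bond: `‖log U̿(c) − tube(c)‖ ≤ 40000ℓ²·Σ_{b read by c}‖X b‖²` under the GLOBAL sup window.
* §3 ★★★ `sum_norm_mlog_dbarAvgU_sub_segMean_le` — the title (`Σ_c … ≤ 40000ℓ²·2d·Σ_b‖X b‖²`); (J1) reading `sum_norm_mlog_dbarCovU_one_sub_segMean_le` — the same for the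
  route's covariant one-step map ✓`Prop7SymAvgTwSym.dbarCovU` AT BACKGROUND `1` (✓`dbarCovU_one`), i.e. F1″ for `f_l` at the flat tower.
HONEST SCOPE.  Kinematics over a landed one-step row; the COVARIANT step (background `Ū₀^{(l)} ≠ 1`, frames `vframeCovU`) = F1″(cov), the telescope F0″, the level masses F3″ and the knit F4″
are other files of the LOCATE.  Flat A6 targets (i)(ii) of the LOCATE §5 are instances of §3.

References: T. Bałaban, CMP 98 (1985) 17–51 [Balaban1985Averaging] ((62) p.28, (89) p.31, (121)–(125) p.36); CMP 95 (1984) 17–40 [Balaban1984PropagatorsI] ((1.11) p.19,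
(1.18)–(1.20) pp.19–20); CMP 102 (1985) 277–309 [Balaban1985Variational] ((44) p.285, Prop. 7 p.299).
-/

set_option autoImplicit false

noncomputable section

open scoped BigOperators
open NormedSpace Finset

namespace Summit.QuantumFields.YangMills.Theorems.Prop7TwistedOneStepDefectFlat

open Literature.MathematicalPhysics.QuantumFieldTheory.Balaban1983to89
open T4Continuum BlockAveraging AveragingRT ExpMeanLog MatrixLog BlockAveragingEMLLinearised
open B10Eq27TorusAxialLog (holT)
open Summit.QuantumFields.YangMills.Theorems.Prop8Chart
open Summit.QuantumFields.YangMills.Theorems.Prop8ChartDoubleBar (dbarAvgU norm_mlog_dbar_sub_segMean_le)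
open Summit.QuantumFields.YangMills.Theorems.Prop7CmapTwSCoarseColumn (sum_indicator_src_add_tgt_eq)
open Summit.QuantumFields.YangMills.Theorems.Prop7SymAvgTwSym (dbarCovU dbarCovU_one)

variable {P : Params} {j : ℕ}
variable {𝔸 : Type*} [NormedRing 𝔸] [NormedAlgebra ℂ 𝔸] [CompleteSpace 𝔸] [NormOneClass 𝔸]

/-! ## §1 Letters: a local radius, incidence of the read set, the multiplicity count -/

omit [NormedAlgebra ℂ 𝔸] [CompleteSpace 𝔸] [NormOneClass 𝔸] in
/-- **A LOCAL SUP RADIUS**: for any finset `R` of bonds and any field `X` there is `r ≥ 0` with `‖X b‖ ≤ r` on `R`, `r ≤ s` whenever `‖X b‖ ≤ s` on `R` and `0 ≤ s`, and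
`r² ≤ Σ_{b∈R} ‖X b‖²` (take the largest norm on `R`, or `0`). [folklore] -/
theorem exists_local_radius (R : Finset (PBond P j)) (X : PBond P j → 𝔸) {s : ℝ} (hs : 0 ≤ s) (hX : ∀ b ∈ R, ‖X b‖ ≤ s) :
    ∃ r : ℝ, 0 ≤ r ∧ (∀ b ∈ R, ‖X b‖ ≤ r) ∧ r ≤ s ∧ r ^ 2 ≤ ∑ b ∈ R, ‖X b‖ ^ 2 := by
  classical
  rcases R.eq_empty_or_nonempty with hR | hR
  · subst hR
    exact ⟨0, le_rfl, fun b hb => by simp at hb, hs, by simp⟩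
  · obtain ⟨b₀, hb₀, hmax⟩ := Finset.exists_max_image R (fun b => ‖X b‖) hR
    refine ⟨‖X b₀‖, norm_nonneg _, fun b hb => hmax b hb, hX b₀ hb₀, ?_⟩
    exact Finset.single_le_sum (f := fun b => ‖X b‖ ^ 2) (fun b _ => sq_nonneg _) hb₀

/-- **A READ BOND'S SOURCE BLOCK IS AN END OF THE COARSE BOND**: the read condition of ✓`norm_mlog_dbar_sub_segMean_le` implies `c.src = B(b₋) ∨ c.tgt = B(b₋)`. [folklore] -/
theorem read_incident (c : PBond P (j + 1)) (b : PBond P j)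
    (h : (blockOf b.src = c.src ∨ blockOf b.src = c.tgt) ∧ (blockOf b.tgt = c.src ∨ blockOf b.tgt = c.tgt)) :
    c.src = blockOf b.src ∨ c.tgt = blockOf b.src := by
  rcases h.1 with h1 | h1
  · exact Or.inl h1.symm
  · exact Or.inr h1.symm

/-- **THE MULTIPLICITY COUNT**: a fine bond is read by at most `2d` coarse bonds, so for `f ≥ 0`
`Σ_c Σ_{b read by c} f b ≤ 2d·Σ_b f b`. [cite: Balaban1984PropagatorsI, (1.18)–(1.20) pp.19–20] -/
theorem sum_read_le_two_d_mul (f : PBond P j → ℝ) (hf : ∀ b, 0 ≤ f b) :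
    ∑ c : PBond P (j + 1), ∑ b ∈ (univ.filter fun b : PBond P j =>
        (blockOf b.src = c.src ∨ blockOf b.src = c.tgt) ∧ (blockOf b.tgt = c.src ∨ blockOf b.tgt = c.tgt)), f b
      ≤ 2 * P.d * ∑ b : PBond P j, f b := by
  classical
  have hstep : ∀ c : PBond P (j + 1), ∑ b ∈ (univ.filter fun b : PBond P j =>
        (blockOf b.src = c.src ∨ blockOf b.src = c.tgt) ∧ (blockOf b.tgt = c.src ∨ blockOf b.tgt = c.tgt)), f b
      ≤ ∑ b : PBond P j, ((if c.src = blockOf b.src then (1 : ℝ) else 0) + (if c.tgt = blockOf b.src then (1 : ℝ) else 0)) * f b := by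
    intro c
    rw [Finset.sum_filter]
    refine Finset.sum_le_sum fun b _ => ?_
    have h2 : 0 ≤ (if c.src = blockOf b.src then (1 : ℝ) else 0) := by split_ifs <;> norm_num
    have h3 : 0 ≤ (if c.tgt = blockOf b.src then (1 : ℝ) else 0) := by split_ifs <;> norm_num
    by_cases h : (blockOf b.src = c.src ∨ blockOf b.src = c.tgt) ∧ (blockOf b.tgt = c.src ∨ blockOf b.tgt = c.tgt)
    · rw [if_pos h]
      have h1 : (1 : ℝ) ≤ (if c.src = blockOf b.src then (1 : ℝ) else 0) + (if c.tgt = blockOf b.src then (1 : ℝ) else 0) := by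
        rcases read_incident c b h with h4 | h4
        · rw [if_pos h4]; linarith
        · rw [if_pos h4]; linarith
      nlinarith [hf b]
    · rw [if_neg h]
      have := hf b
      positivity
  calc _ ≤ ∑ c : PBond P (j + 1), ∑ b : PBond P j, ((if c.src = blockOf b.src then (1 : ℝ) else 0) + (if c.tgt = blockOf b.src then (1 : ℝ) else 0)) * f b :=
        Finset.sum_le_sum fun c _ => hstep c
    _ = ∑ b : PBond P j, (∑ c : PBond P (j + 1), ((if c.src = blockOf b.src then (1 : ℝ) else 0) + (if c.tgt = blockOf b.src then (1 : ℝ) else 0))) * f b := by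
        rw [Finset.sum_comm]; exact Finset.sum_congr rfl fun b _ => by rw [Finset.sum_mul]
    _ = ∑ b : PBond P j, (2 * P.d) * f b := Finset.sum_congr rfl fun b _ => by rw [sum_indicator_src_add_tgt_eq]
    _ = 2 * P.d * ∑ b : PBond P j, f b := by rw [Finset.mul_sum]

/-! ## §2 ★★ The per-bond defect in local mass currency -/

/-- ★★ **THE ONE-STEP DOUBLE-BAR DEFECT AT ONE COARSE BOND, LOCAL MASS² ON THE RIGHT**: for `U = exp X` with the GLOBAL sup window `‖X b‖ ≤ s`, `200ℓs ≤ 1`: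
`‖mlog U̿(c) − |I|⁻¹Σ_i X([x,x′]_i(c))‖ ≤ 40000·ℓ²·Σ_{b read by c} ‖X b‖²`. [cite: Balaban1985Averaging, (62) p.28, (89) p.31, (121)–(125) p.36] -/
theorem norm_mlog_dbarAvgU_sub_segMean_le_localMass (hj : j + 1 ≤ P.m + P.K) {S : GaugeField P j 𝔸ˣ} {X : PBond P j → 𝔸} {s : ℝ}
    (hs0 : 0 ≤ s) (hℓs : 200 * (((P.d + 2) * P.L : ℕ) : ℝ) * s ≤ 1)
    (hSX : ∀ b : PBond P j, ((S b : 𝔸ˣ) : 𝔸) = exp (X b)) (hX : ∀ b : PBond P j, ‖X b‖ ≤ s) (c : PBond P (j + 1)) :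
    ‖mlog ((dbarAvgU S c : 𝔸ˣ) : 𝔸) -
        ((Fintype.card (Idx P) : ℂ))⁻¹ • ∑ i : Idx P,
          walkSum X (walk (walkEnd (emb c.src) (stairWord i.2.1 (off i.1))) (List.replicate P.L (c.dir, true)))‖ ≤
      40000 * (((P.d + 2) * P.L : ℕ) : ℝ) ^ 2 * ∑ b ∈ (univ.filter fun b : PBond P j =>
        (blockOf b.src = c.src ∨ blockOf b.src = c.tgt) ∧ (blockOf b.tgt = c.src ∨ blockOf b.tgt = c.tgt)), ‖X b‖ ^ 2 := by
  classical
  set R : Finset (PBond P j) := univ.filter fun b : PBond P j =>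
    (blockOf b.src = c.src ∨ blockOf b.src = c.tgt) ∧ (blockOf b.tgt = c.src ∨ blockOf b.tgt = c.tgt) with hRdef
  have hmemR : ∀ b : PBond P j, (blockOf b.src = c.src ∨ blockOf b.src = c.tgt) → (blockOf b.tgt = c.src ∨ blockOf b.tgt = c.tgt) → b ∈ R := fun b h1 h2 => by
    rw [hRdef, Finset.mem_filter]; exact ⟨Finset.mem_univ _, h1, h2⟩
  obtain ⟨r, hr0, hXr, hrs, hr2⟩ := exists_local_radius R X hs0 (fun b _ => hX b)
  have hℓ0 : 0 ≤ (((P.d + 2) * P.L : ℕ) : ℝ) := Nat.cast_nonneg _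
  have hℓr : 200 * (((P.d + 2) * P.L : ℕ) : ℝ) * r ≤ 1 := (mul_le_mul_of_nonneg_left hrs (by positivity)).trans hℓs
  have h := norm_mlog_dbar_sub_segMean_le hj c hr0 hℓr (fun b _ _ => hSX b) (fun b h1 h2 => hXr b (hmemR b h1 h2))
  exact h.trans (mul_le_mul_of_nonneg_left hr2 (by positivity))

/-! ## §3 ★★★ The one-step defect summed over the coarse bonds -/

/-- ★★★ **THE ONE-STEP DOUBLE-BAR DEFECT IN MASS CURRENCY (FLAT BACKGROUND)** — the `hr` row of ✓`jointRow_of_levelMasses` for print's framed one-step average (89):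
for `U = exp X`, `‖X b‖ ≤ s`, `200ℓs ≤ 1`, `Σ_c ‖mlog U̿(c) − |I|⁻¹Σ_i X([x,x′]_i(c))‖ ≤ 40000ℓ²·(2d)·Σ_b ‖X b‖²`.
[cite: Balaban1985Averaging, (62) p.28, (89) p.31, (121)–(125) p.36; Balaban1984PropagatorsI, (1.18)–(1.20) pp.19–20; Balaban1985Variational, (44) p.285] -/
theorem sum_norm_mlog_dbarAvgU_sub_segMean_le (hj : j + 1 ≤ P.m + P.K) {S : GaugeField P j 𝔸ˣ} {X : PBond P j → 𝔸} {s : ℝ}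
    (hs0 : 0 ≤ s) (hℓs : 200 * (((P.d + 2) * P.L : ℕ) : ℝ) * s ≤ 1)
    (hSX : ∀ b : PBond P j, ((S b : 𝔸ˣ) : 𝔸) = exp (X b)) (hX : ∀ b : PBond P j, ‖X b‖ ≤ s) :
    ∑ c : PBond P (j + 1), ‖mlog ((dbarAvgU S c : 𝔸ˣ) : 𝔸) -
        ((Fintype.card (Idx P) : ℂ))⁻¹ • ∑ i : Idx P,
          walkSum X (walk (walkEnd (emb c.src) (stairWord i.2.1 (off i.1))) (List.replicate P.L (c.dir, true)))‖ ≤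
      40000 * (((P.d + 2) * P.L : ℕ) : ℝ) ^ 2 * (2 * P.d) * ∑ b : PBond P j, ‖X b‖ ^ 2 := by
  classical
  have hmult := sum_read_le_two_d_mul (P := P) (j := j) (fun b => ‖X b‖ ^ 2) (fun b => sq_nonneg _)
  calc _ ≤ ∑ c : PBond P (j + 1), 40000 * (((P.d + 2) * P.L : ℕ) : ℝ) ^ 2 * ∑ b ∈ (univ.filter fun b : PBond P j =>
          (blockOf b.src = c.src ∨ blockOf b.src = c.tgt) ∧ (blockOf b.tgt = c.src ∨ blockOf b.tgt = c.tgt)), ‖X b‖ ^ 2 :=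
        Finset.sum_le_sum fun c _ => norm_mlog_dbarAvgU_sub_segMean_le_localMass hj hs0 hℓs hSX hX c
    _ = 40000 * (((P.d + 2) * P.L : ℕ) : ℝ) ^ 2 * ∑ c : PBond P (j + 1), ∑ b ∈ (univ.filter fun b : PBond P j =>
          (blockOf b.src = c.src ∨ blockOf b.src = c.tgt) ∧ (blockOf b.tgt = c.src ∨ blockOf b.tgt = c.tgt)), ‖X b‖ ^ 2 := by rw [Finset.mul_sum]
    _ ≤ 40000 * (((P.d + 2) * P.L : ℕ) : ℝ) ^ 2 * (2 * P.d * ∑ b : PBond P j, ‖X b‖ ^ 2) := mul_le_mul_of_nonneg_left hmult (by positivity)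
    _ = _ := by ring

/-- ★★★ **(J1) READING: THE SAME ROW FOR THE ROUTE'S COVARIANT ONE-STEP MAP AT THE FLAT BACKGROUND** — `dbarCovU 1 S = dbarAvgU S` literally (✓`Prop7SymAvgTwSym.dbarCovU_one`),
so F1″ for `f_l := log ∘ dbarCovU(Ū₀ˡ, ·)` at `Ū₀ˡ = 1` reads: `Σ_c ‖mlog (dbarCovU 1 (exp X))(c) − |I|⁻¹Σ_i X([x,x′]_i(c))‖ ≤ 40000ℓ²·(2d)·Σ_b ‖X b‖²`.
[cite: Balaban1985Averaging, (89) p.31, (110) p.34, (121)–(125) p.36; Balaban1985Variational, (44) p.285] -/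
theorem sum_norm_mlog_dbarCovU_one_sub_segMean_le (hj : j + 1 ≤ P.m + P.K) {S : GaugeField P j 𝔸ˣ} {X : PBond P j → 𝔸} {s : ℝ}
    (hs0 : 0 ≤ s) (hℓs : 200 * (((P.d + 2) * P.L : ℕ) : ℝ) * s ≤ 1)
    (hSX : ∀ b : PBond P j, ((S b : 𝔸ˣ) : 𝔸) = exp (X b)) (hX : ∀ b : PBond P j, ‖X b‖ ≤ s) :
    ∑ c : PBond P (j + 1), ‖mlog ((dbarCovU (fun _ : PBond P j => (1 : 𝔸ˣ)) S c : 𝔸ˣ) : 𝔸) -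
        ((Fintype.card (Idx P) : ℂ))⁻¹ • ∑ i : Idx P,
          walkSum X (walk (walkEnd (emb c.src) (stairWord i.2.1 (off i.1))) (List.replicate P.L (c.dir, true)))‖ ≤
      40000 * (((P.d + 2) * P.L : ℕ) : ℝ) ^ 2 * (2 * P.d) * ∑ b : PBond P j, ‖X b‖ ^ 2 := by
  rw [dbarCovU_one]
  exact sum_norm_mlog_dbarAvgU_sub_segMean_le hj hs0 hℓs hSX hX

end Summit.QuantumFields.YangMills.Theorems.Prop7TwistedOneStepDefectFlat

end
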